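import Literature.IUT.LogVolume.DifferentLocalCriterion
import Literature.IUT.LogVolume.FundamentalIdentity
import Literature.IUT.LogVolume.TameDualPair
import HarnessLib

/-!
# WILD ⟺ `d ≥ 1`: the trace-form hypothesis of the dividing line in [IUTchIV]'s invariant `d` (order of the different)

abc-iut cell, seat abc-iut-E-t42 (gen 4; rung LADDER-ABC:A2.RESCUE.J, R-J row Y-29b).  PROOF-ONLY classical local arithmetic
(Serre, *Local Fields* III §3 Prop. 7, §6 Prop. 13); no definition, no `Prop` fact, no `sorry`.  The two kernel halves of row Y-29b's dividing
line under the isometric (Ind2) are keyed to the trace form of `K_v/ℚ_p` on the integers — WILD `∀ x, ‖x‖ ≤ 1 → ‖Tr x‖ < 1` (negative half,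
`Summit.ABC.IUTFork.Joshi.PinsIsometricShear…`, p457646) versus its negation (positive half, `TameDualPair` p464861 /
`Summit.ABC.IUTFork.Joshi.PinsIsometricLine…`, p465219).  HERE that key is translated into the invariant print uses, [IUTchIV] Prop. 1.1's
`d_v` = abc-iut-S1's `differentOrd` (`ord(p) = 1`):

* **`forall_norm_trace_lt_one_iff_one_le_differentOrd`** — wild ⟺ `1 ≤ d` (⟺ `𝔪^e ∣ 𝔇`): abc-iut-S1's local criterion
  `div_le_differentOrd_iff_trace` at `n = e`, `𝔪^e = p·𝒪_K` (`span_natCast_prime_eq`), and the value group `p^ℤ` of `ℚ_p`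
  (`padicNorm_le_one_of_lt`);
* `not_forall_norm_trace_lt_one_iff_differentOrd_lt_one` — tame ⟺ `d < 1`;
* **`exists_galoisOrder_repr_of_isometry_of_differentOrd_lt_one`** — `d < 1` and `K/ℚ_p` Galois ⟹ every `ℚ_p`-linear isometry is a unit of
  `𝒪_K⟨Gal(K/ℚ_p)⟩` (the `hIsmG` shape of the cell's `PinsGaloisOrder`, p460152).

So, in print's currency: at the places over ramified primes, `d_v < 1` (+ Galois) ⟹ the isometric (Ind2) keeps the typed pins INHABITED;
`d_v ≥ 1` at one place over an odd bad-place-free prime ⟹ EMPTY.  Nothing here is disputed mathematics; the consumer rows are the cell's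
typings [claim: Mochizuki2012, status: disputed] of (Ind2). [cite: SerreLocalFields1979, Ch. III §3, Prop. 7] [cite: Mochizuki2012, IUTchIV Prop. 1.1 p. 9]
-/

noncomputable section

open Module IsLocalRing
open scoped NormedField

namespace Literature.IUT.LogVolume

namespace TameDualPair

variable {p : ℕ} [Fact p.Prime]
variable {K : Type} [NontriviallyNormedField K] [NormedAlgebra ℚ_[p] K] [IsUltrametricDist K] [ProperSpace K]

/-- A `p`-adic number of norm `< p` has norm `≤ 1` (the value group of `ℚ_p` is `p^ℤ`). [folklore] -/
private theorem padicNorm_le_one_of_lt (t : ℚ_[p]) (ht : ‖t‖ < p) : ‖t‖ ≤ 1 := by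
  by_cases h0 : t = 0
  · rw [h0, norm_zero]; exact zero_le_one
  have hp1 : (1 : ℝ) < p := by exact_mod_cast (Fact.out : p.Prime).one_lt
  rw [Padic.norm_eq_zpow_neg_valuation h0] at ht ⊢
  have h1 : -t.valuation < 1 := by
    rw [← zpow_lt_zpow_iff_right₀ hp1, zpow_one]
    exact ht
  calc (p : ℝ) ^ (-t.valuation) ≤ (p : ℝ) ^ (0 : ℤ) := zpow_le_zpow_right₀ hp1.le (by omega)
    _ = 1 := zpow_zero _

variable (p K) in
/-- **WILD ⟺ `d ≥ 1`.**  The trace form of `K/ℚ_p` is wild on the integers — `∀ x, ‖x‖ ≤ 1 → ‖Tr_{K/ℚ_p} x‖ < 1`, the hypothesis `hwild`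
of the cell's negative half (p457646) — iff the normalised order of the different ([IUTchIV] Prop. 1.1's `d`; `ord(p) = 1`, abc-iut-S1's
`differentOrd`) is `≥ 1`, i.e. `𝔪_K^e ∣ 𝔇_{K/ℚ_p}`: the tree's local criterion `div_le_differentOrd_iff_trace` at `n = e` with
`𝔪^e = p·𝒪_K` (`span_natCast_prime_eq`).  (Classically: `d = (e − 1)/e` iff tame, `d ≥ 1` iff wild.)
[cite: SerreLocalFields1979, Ch. III §3, Prop. 7; §6, Prop. 13] [cite: Mochizuki2012, IUTchIV Prop. 1.1 p. 9] -/
theorem forall_norm_trace_lt_one_iff_one_le_differentOrd :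
    (∀ x : K, ‖x‖ ≤ 1 → ‖Algebra.trace ℚ_[p] K x‖ < 1) ↔ 1 ≤ differentOrd p K := by
  have he : (0 : ℝ) < absRamificationIdx p K := by exact_mod_cast absRamificationIdx_pos p K
  have h1 : ((absRamificationIdx p K : ℕ) : ℝ) / absRamificationIdx p K = 1 := div_self he.ne'
  have hpQ : ((p : ℕ) : ℚ_[p]) ≠ 0 := by exact_mod_cast (Fact.out : p.Prime).ne_zero
  have hpK : (p : K) = algebraMap ℚ_[p] K (p : ℚ_[p]) := by rw [map_natCast]
  have hnp : ‖((p : ℕ) : ℚ_[p])‖ = (p : ℝ)⁻¹ := Padic.norm_p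
  have hp0 : (0 : ℝ) < p := by exact_mod_cast (Fact.out : p.Prime).pos
  -- `𝔪^e = (p)`: membership means divisibility by `p`
  have hmem : ∀ b : Valued.integer K, b ∈ maximalIdeal (Valued.integer K) ^ absRamificationIdx p K ↔
      ∃ c : Valued.integer K, b = (p : Valued.integer K) * c := fun b => by
    rw [← span_natCast_prime_eq p K, Ideal.mem_span_singleton']
    exact ⟨fun ⟨c, hc⟩ => ⟨c, by rw [← hc, mul_comm]⟩, fun ⟨c, hc⟩ => ⟨c, by rw [hc, mul_comm]⟩⟩
  have key := div_le_differentOrd_iff_trace p K (absRamificationIdx p K)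
  rw [h1] at key
  rw [key]
  constructor
  · intro hw z hz y hy
    -- `b = p ∈ 𝔪^e` gives `‖p z‖ ≤ 1`, so `x := p z y ∈ 𝒪_K` and `‖Tr x‖ = ‖Tr(zy)‖/p < 1`
    have hpz : ‖(p : K) * z‖ ≤ 1 := by
      have h := hz (p : Valued.integer K) ((hmem _).mpr ⟨1, by rw [mul_one]⟩)
      rwa [SubringClass.coe_natCast] at h
    have hx : ‖(p : K) * z * y‖ ≤ 1 := by
      rw [norm_mul]; exact mul_le_one₀ hpz (norm_nonneg _) hy
    have h2 := hw _ hx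
    rw [mul_assoc, hpK, ← Algebra.smul_def, map_smul, norm_smul, hnp] at h2
    have h3 : ‖Algebra.trace ℚ_[p] K (z * y)‖ < p := by
      rwa [inv_mul_lt_iff₀ hp0, mul_one] at h2
    exact padicNorm_le_one_of_lt _ h3
  · intro hC x hx
    -- `z := x / p ∈ 𝔪^{−e}`; the criterion with `y = 1` gives `‖Tr x‖ / ‖p‖ ≤ 1`
    have hpK0 : (p : K) ≠ 0 := by rw [hpK]; exact (map_ne_zero _).mpr hpQ
    have hz : ∀ b ∈ maximalIdeal (Valued.integer K) ^ absRamificationIdx p K, ‖(b : K) * ((p : K)⁻¹ * x)‖ ≤ 1 := by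
      intro b hb
      obtain ⟨c, rfl⟩ := (hmem b).mp hb
      have hcx : ((((p : Valued.integer K) * c : Valued.integer K)) : K) * ((p : K)⁻¹ * x) = (c : K) * x := by
        rw [Subring.coe_mul, SubringClass.coe_natCast, mul_comm (p : K) (c : K), mul_assoc, ← mul_assoc (p : K),
          mul_inv_cancel₀ hpK0, one_mul]
      rw [hcx, norm_mul]
      exact mul_le_one₀ (Valued.integer.norm_le_one c) (norm_nonneg _) hx
    have h2 := hC _ hz 1 (by rw [norm_one])
    rw [mul_one, hpK, ← map_inv₀, ← Algebra.smul_def, map_smul, norm_smul, norm_inv, hnp, inv_inv] at h2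
    have hp1 : (1 : ℝ) < p := by exact_mod_cast (Fact.out : p.Prime).one_lt
    calc ‖Algebra.trace ℚ_[p] K x‖ = (p : ℝ)⁻¹ * ((p : ℝ) * ‖Algebra.trace ℚ_[p] K x‖) := by
          rw [← mul_assoc, inv_mul_cancel₀ hp0.ne', one_mul]
      _ ≤ (p : ℝ)⁻¹ * 1 := by gcongr
      _ < 1 := by rw [mul_one]; exact inv_lt_one_of_one_lt₀ hp1

variable (p K) in
/-- **TAME ⟺ `d < 1` ⟺ a norm-unimodular trace-dual pair** (with `TameDualPair.exists_normUnimodular_dualPair_iff_not_wild`).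
[cite: SerreLocalFields1979, Ch. III §3, Prop. 7] [cite: Mochizuki2012, IUTchIV Prop. 1.1 p. 9] -/
theorem not_forall_norm_trace_lt_one_iff_differentOrd_lt_one :
    (¬ ∀ x : K, ‖x‖ ≤ 1 → ‖Algebra.trace ℚ_[p] K x‖ < 1) ↔ differentOrd p K < 1 := by
  rw [forall_norm_trace_lt_one_iff_one_le_differentOrd p K, not_le]

/-- **`d < 1` (tame) and Galois ⟹ every `ℚ_p`-linear isometry of `K` is a unit of the integral Galois order `𝒪_K⟨Gal(K/ℚ_p)⟩`** — the
`hIsmG` shape of the cell's `Summit.ABC.IUTFork.Joshi.PinsGaloisOrder` (p460152), in [IUTchIV]'s own invariant `d`; whereas `d ≥ 1` (wild)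
and `p` odd give the cell's isometric shear OUTSIDE the order (p457646). [cite: SerreLocalFields1979, Ch. III §3, Prop. 7]
[cite: Mochizuki2012, IUTchIV Prop. 1.1 p. 9] -/
theorem exists_galoisOrder_repr_of_isometry_of_differentOrd_lt_one [FiniteDimensional ℚ_[p] K] [IsGalois ℚ_[p] K]
    (hd : differentOrd p K < 1) (g : K ≃ₗ[ℚ_[p]] K) (hg : ∀ x, ‖g x‖ = ‖x‖) :
    (∃ (T : Finset (K ≃ₐ[ℚ_[p]] K)) (c : (K ≃ₐ[ℚ_[p]] K) → K), (∀ τ ∈ T, ‖c τ‖ ≤ 1) ∧ ∀ x, g x = ∑ τ ∈ T, c τ * τ x) ∧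
    (∃ (T : Finset (K ≃ₐ[ℚ_[p]] K)) (c : (K ≃ₐ[ℚ_[p]] K) → K), (∀ τ ∈ T, ‖c τ‖ ≤ 1) ∧ ∀ x, g.symm x = ∑ τ ∈ T, c τ * τ x) :=
  exists_galoisOrder_repr_of_isometry_of_not_wild ((not_forall_norm_trace_lt_one_iff_differentOrd_lt_one p K).mpr hd) g hg

end TameDualPair

end Literature.IUT.LogVolume

end
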